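import Literature.MathematicalPhysics.QuantumFieldTheory.Balaban1983to89.B7Prop3GeneralRotated

/-!
# Bałaban's renormalization group for 4-d lattice Yang–Mills — B7 Proposition 3 (121)–(126) AT A GENERAL BACKGROUND
`V₀`, the LINEAR PART, file 1: the objects (121)–(122) for the double-bar average (89) of `V₁ = e^{A}` at the background
`V₀` (`B7Eq92Concrete.dbavgCov`), the exponent of (112) and the derivative of the block frames `\overline{R_{0,y}V₁}`, the
MAIN TERM (125) `(Q₀A)_c = Σ_{x∈B(c₋)} L^{−(d+1)}(R_{0,c₋}A)([x, x′])` with its bound `|(Q₀A)_c| ≤ |A|`, and the FRAME PART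
of (120)/(124): «L(Q(V₀)A)_c» `= −F̂_{V₀}(c₋) + DṼ₁ + R̄_{0,c}F̂_{V₀}(c₊)` (`B7Prop3GeneralLinear`)

CITATION HEADER (lean-in-tree rule 2026-08-18).  Audit cell `pub-balaban`, sub-cell `t4` (NE7c ROUND-2 crew, seat
`b2b-balaban-t4-ne7c-formalise-leaf-05` gen 6; owner table `t4/b2b-balaban-t4-ne7c-p1/LEAVES-NE7c-P1.md` v2.3 row S55
«[B7] PROPOSITION 3 AT A GENERAL REGULAR BACKGROUND» — WALL §2 (a) item `Cf` = B11's citation of [Balaban1985Averaging]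
Prop. 4, owner FINDING F-ne7cp1-g28-1; custody notice to the b07 lineage journalled before filing).  Source: T. Bałaban,
*Averaging operations for lattice gauge theories*, Commun. Math. Phys. **98**, 17–51 (1985) [Balaban1985Averaging]
(cell paper B7; journal page = PDF page + 16), Sect. D pp. 34–36 [PDF 18–20] ((109)–(126), Proposition 3), quoted from the
page renders `b2b-balaban-ref1/pages/1985-cmp98-averaging/1985-cmp98-averaging-p018-x2.png`, `-p019-x2.png`,
`-p020-x2.png` READ AS IMAGES by this seat (2026-08-20); (89) p. 31 and (59) p. 27 through the verbatim quotations of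
`B7Eq92Concrete`.
Companions (all REUSED BY NAME, none modified): `B7Prop3GeneralRotated` (this seat: `tsum` = `(R_{0,y}A)(Γ)` and its
derivative characterisation), `B7Eq92Concrete` (b07 gen 19: the general-background objects `tHol` (58), `Fcov`/`wframe`
(110)/(82), `tild` (65) = `Ṽ₁`, `dbavgCov` (89) = `V̿₁`, `Rc` (56), and their flat reductions), `B7Prop3Flat` (b07 gens
16–18: the same objects AT `V₀ = 1` — `Fhat`, `Q0form`, `linQ`, `dbavg`, `expCfg` — and
`hasDerivAt_mlog_dbavg_complexRay`), `B7Prop1Explicit` (`hol`, `treeWord`, `boxVec`, `seg`, `bavg` (42), `U1`),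
`B7Eq78Linearization` (`conjR`, `hasDerivAt_mlog_comp`, `hasDerivAt_exp_comp_zero`, `hasDerivAt_conjR_comp`),
`B8Ineq130` (`hol_one`, `bavg_one`), `MatrixLog` (`mlog`, `mlog_one`).

THE PRINTED TEXT (verbatim from the renders).  p. 34 (109)–(112) as quoted in `B7Prop3GeneralRotated`; (113):
"(Ṽ₁)_c = (\overline{V₁V₀})_c(V̄₀)_c⁻¹ = exp[i Σ_{x∈B(c₋)} L^{−d} (1/i) log(V₁V₀)(Γ_{c,x}∪(−c))]·(V₁V₀)(c)V₀(c)⁻¹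
exp[−i Σ_{x∈B(c₋)} L^{−d} (1/i) log V₀(Γ_{c,x}∪(−c))] = …", (114): "A_x = (1/i) log(R_{0,c₋}V₁)(Γ_{c,x}∪(−c)),
Y_x = (1/i) log V₀(Γ_{c,x}∪(−c))."  p. 35 (120): "(V̿₁)_c = (\overline{R_{0,c₋}V₁})⁻¹(Ṽ₁)_c R̄_{0,c}\overline{R_{0,c₊}V₁}
= exp[−i Σ_{x∈B(c₋)} L^{−d}(R_{0,c₋}A)(Γ_{c₋,x}) + i(Q′(V₀)A)_c + i Σ_{x′∈B(c₊)} L^{−d} R̄_{0,c}(R_{0,c₊}A)(Γ_{c₊,x′})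
+ O(L²α₁²)]."  p. 36: "Let us define Q(V₀, A, c) = (1/i) log(V̿₁)_c, (121) then Q(V₀, A, c) is an analytic function of
A and from (120) it follows that its Taylor expansion begins with a first-order polynomial. Let us denote it by
L(Q(V₀)A)_c. Thus we have Q(V₀, A, c) = L(Q(V₀)A)_c + C(V₀, A, c). (122)  C(V₀, A, c) is an analytic function of A whose
Taylor's expansion begins with a second-order polynomial (a quadratic form), and |C(V₀, A, c)| ≤ C₁L²|A|² < C₁(Lα₁)².
(123)"; (124) = the five-term linear form; "The first term on the right-hand side above is the main term in this linear
form, and it resembles the definition of the averaging operation Q in [2]. The remaining terms are small because the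
functions g(−z), g⁻¹(z), e^{iz} are equal to 1 for z = 0, so the operators occurring in these terms can be estimated by
O(L²α₀) and the terms can be estimated by O(1)L²α₀L|A| < O(1)L²α₀Lα₁. We will denote the main term by Q_{V₀}, or Q₀
(Q₀A)_c = (Q_{V₀}A)_c = Σ_{x∈B(c₋)} L^{−(d+1)}(R_{0,c₋}A)([x, x′]), (125) and it has an estimate |(Q₀A)_c| ≤ |A| < α₁, so
we have for the whole linear term |(Q(V₀)A)_c| ≤ |A| + O(1)L²α₀|A| < (1 + O(1)L²α₀)α₁ < e^{O(1)L²α₀}α₁. (126) Thus we have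
proved the following **Proposition 3.** There exist constants C₁, c₃, c₃ ≤ c₂, such that for α₀, α₁ ≤ c₃ the function
Q(V₀, A) = (1/i) log V̿₁ is an analytic function of A satisfying the equalities and bounds (122)–(124). The constant C₁
depends on d and c₃ depends on d and L."  READING of (122) (cell census C-adv4-22, as in `B7Prop3Flat`): «L(Q(V₀)A)_c» =
`L·(Q(V₀)A)_c` with `L` the block size.

DICTIONARY print ↦ Lean (b07 conventions; see `B7Prop3GeneralRotated`).  The `L`-bond `c = ⟨q, q + Le_κ⟩` ↦ `(q, κ)`,
`c₋ = q`, `c₊ = q + L•e κ`, `x = q + r ∈ B(c₋)` ↦ `boxVec L r`, `Γ_{c₋,x}` ↦ `treeWord (boxVec L r)`, `[x, x′]` ↦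
`seg κ L` from `q + r`; `R̄_{0,c} = R((V̄₀)_c)` ↦ `conjR (bavg L V₀ q κ)` on the algebra (`Rc` on the group); (121)
`Q(V₀, A, c)` ↦ **`Qcov L V₀ A q κ := mlog (dbavgCov L V₀ (expCfg A) q κ)`**; (122) «L(Q(V₀)A)_c» ↦ **`linQcov`** :=
the `t`-derivative at `0` of `t ↦ Q(V₀, tA, c)` (print DEFINES the linear part as the first-order Taylor term — Mathlib
`deriv`, complex `t`), `C(V₀, A, c)` ↦ **`Ccov := Qcov − linQcov`**; the exponent of (112) `Σ_{x∈B(y)} L^{−d}(R_{0,y}A)(Γ_{y,x})`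
↦ **`FhatCov L V₀ A y`**; (125) `(Q₀A)_c` ↦ **`Q0cov L V₀ A q κ`**, the summand `(R_{0,c₋}A)([x,x′])` being the
`[x,x′]`-piece `R(V₀(Γ_{c₋,x}))·(R_{0,x}A)([x,x′])` of `(R_{0,c₋}A)(Γ_{c₋,x}∪[x,x′])` (`tsum_treeWord_seg`); `|A|` ↦ a bound
`a` on `‖A x κ‖`.

WHAT THIS FILE PROVES (kernel, no `sorry`, standard axioms; hypotheses ONLY where displayed — `U1` background and
`|A_b| ≤ a` for the norm bound, a bound `M` on `A` for the flat reduction of `linQcov`):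
* §3 `FhatCov`; `FhatCov_one_left` (= `Fhat`); **`hasDerivAt_Fcov_expCfg`**, `hasDerivAt_wframe_expCfg`,
  `hasDerivAt_wframe_inv_expCfg` — (110)–(112) linearised: along `V₁ = e^{tA}` the block frame `\overline{R_{0,y}V₁}` and
  its inverse have `t`-derivatives `±F̂_{V₀}(y)` at `0`.
* §4 `Q0cov` (125); `tsum_treeWord_seg`; `Q0cov_one_left` (= `Q0form`); **`norm_Q0cov_le`** — "|(Q₀A)_c| ≤ |A|" at a
  general background in `U1`.
* §5 `Qcov` (121), `Qcov_one_left`, `dbavgCov_one_right` (`V̿₁ = 1` at `V₁ = 1`, every background), **`Qcov_zero`**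
  (`Q(V₀, 0, c) = 0`: no constant Taylor term), `linQcov`/`Ccov` (122) with `Qcov_eq_linQcov_add_Ccov`, `linQcov_one_left`
  (= `linQ` of `B7Prop3Flat`, by its `hasDerivAt_mlog_dbavg_complexRay`), and **`hasDerivAt_Qcov_of_tild`** ∕
  `linQcov_eq_of_tild` — THE FRAME PART OF (120): if `Ṽ₁(c)` has `t`-derivative `D` then
  «L(Q(V₀)A)_c» `= −F̂_{V₀}(c₋) + D + R̄_{0,c}F̂_{V₀}(c₊)`.
ABSOLUTE-RULE LEDGER.  No `B7.Prop*` placeholder, no Literature `Prop`-fact, nothing of the manuscript cited as a fact;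
new definitions `FhatCov`, `Q0cov`, `Qcov`, `linQcov`, `Ccov` over the lineage's concrete objects; `B7.Prop3Printed` is
neither used nor claimed.
NOT CERTIFIED HERE (located; the row's remaining work).  (i) `D` itself — the derivative of `Ṽ₁` (113)–(119), print's
`(Q′(V₀)A)_c` with the operators `g(−i ad_Y)`, `g⁻¹(∓i ad_{Y_x})`, `e^{±i ad_Y}` (the Fréchet derivatives of `exp`/`log`
at the points `iY`, `e^{iY_x}`); (ii) the regrouping (124) and the bound (126) `|(Q(V₀)A)_c| ≤ (1 + O(1)L²α₀)|A|` (needs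
(i), the loop smallness `|Y_x| = O(L²α₀)` from (109) via Prop. 1, and the identity `(R_{0,c₋}A)(Γ_{c₊,x′}) =
e^{−i ad_Y}R̄_{0,c}(R_{0,c₊}A)(Γ_{c₊,x′})` of p. 35); (iii) analyticity of `Q(V₀, ·, c)` and (123) (rows S55-analytic ∕
S58); (iv) that `linQcov` is LINEAR in `A` (it follows from (i)–(ii), or from (iii)).
DIVERGENCES from print (cell DIVERGENCE.md, row filed with the LANDED line).  (a) (122)'s linear part is typed as the
derivative at `0` along the complex ray through `A` (for the analytic `Q` of Prop. 3 this IS the first-order Taylor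
polynomial evaluated at `A`); `C` as the difference.  (b) Setting and `log` as in the lineage (`ℤ^d`, units of a complete
normed `ℂ`-algebra, series logarithm (21), the `i` absorbed); no smallness is assumed anywhere in this file — (121)–(122)
are definitions, (125)'s bound needs only `U1`.  (c) `R̄_{0,c}` acts on the algebra by `conjR` (= `Rc` on units).
VALUE.  Prop. 3's OBJECTS at a curved background kernel-defined on top of the lineage's (89), with the flat reductions
to `B7Prop3Flat`, the main term (125) bounded as printed, and the frame contributions to (120)/(124) computed — the
linear part is reduced to the derivative of `Ṽ₁`; NOT summit progress (NE7c NOT PROVED; spine PROVED 0∕9; rung (B)+1 on a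
finite T⁴ — NOT infinite volume, NOT mass gap, NOT Clay).
-/

noncomputable section

open scoped BigOperators
open NormedSpace Finset

namespace Literature.MathematicalPhysics.QuantumFieldTheory.Balaban1983to89.B7Prop3GeneralLinear

open B7Prop1Explicit B7Prop3Flat B7Eq92Concrete MatrixLog B7Prop3GeneralRotated
open B7Eq78Linearization (conjR conjR_apply conjR_one hasDerivAt_mlog_comp hasDerivAt_exp_comp_zero
  hasDerivAt_conjR_comp)
open B8Ineq130 (hol_one bavg_one)

-- `Site` alone would resolve to the torus sites of `Setup.lean`; re-export the `ℤ^d` sites of `B7Prop1Explicit`.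
export B7Prop1Explicit (Site)

variable {d : ℕ}

variable {𝔸 : Type*} [NormedRing 𝔸] [NormedAlgebra ℂ 𝔸] [CompleteSpace 𝔸]

/-! ## §3 The block frames: the exponent of (112) at a general background and the derivative of `\overline{R_{0,y}V₁}` -/

section Frames

variable (L : ℕ)

omit [CompleteSpace 𝔸] in
/-- **the exponent of (112) at the background `V₀`**: `F̂_{V₀}(y) := Σ_{x∈B(y)} L^{−d} (R_{0,y}A)(Γ_{y,x})`
("\overline{R_{0,y}V₁} = exp[i Σ_{x∈B(y)} L^{−d}(R_{0,y}A)(Γ_{y,x}) + O(L²α₁²)]"); at `V₀ = 1` it is `B7Prop3Flat.Fhat`.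
[cite: Balaban1985Averaging, (112) p.34] -/
def FhatCov (V₀ : Site d → Fin d → 𝔸ˣ) (A : Site d → Fin d → 𝔸) (y : Site d) : 𝔸 :=
  ∑ r : Fin d → Fin L, (((L : ℝ) ^ d)⁻¹) • tsum V₀ A y (treeWord (boxVec L r))

omit [CompleteSpace 𝔸] in
/-- flat reduction: `F̂_{1} = F̂` of `B7Prop3Flat`. [cite: Balaban1985Averaging, (112) p.34] -/
@[simp] theorem FhatCov_one_left (A : Site d → Fin d → 𝔸) (y : Site d) :
    FhatCov L (1 : Site d → Fin d → 𝔸ˣ) A y = Fhat L A y := by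
  simp [FhatCov, Fhat]

/-- **(110)–(112) linearised**: the exponent `F(y) = Σ_x L^{−d} log (R_{0,y}e^{tA})(Γ_{y,x})` of the block frame
(`B7Eq92Concrete.Fcov`) has `t`-derivative `F̂_{V₀}(y)` at `t = 0`. [cite: Balaban1985Averaging, (110)–(112) p.34] -/
theorem hasDerivAt_Fcov_expCfg (V₀ : Site d → Fin d → 𝔸ˣ) (A : Site d → Fin d → 𝔸) (y : Site d) :
    HasDerivAt (fun t : ℂ => Fcov L V₀ (expCfg (t • A)) y) (FhatCov L V₀ A y) 0 := by
  unfold Fcov FhatCov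
  refine HasDerivAt.fun_sum fun r _ => ?_
  have h := (hasDerivAt_mlog_tHol_expCfg V₀ A y (treeWord (boxVec L r))).const_smul (((L : ℝ) ^ d)⁻¹)
  exact h

/-- the exponent (110) vanishes at `t = 0` (`log 1 = 0` termwise). [cite: Balaban1985Averaging, (110) p.34] -/
theorem Fcov_expCfg_zero_smul (V₀ : Site d → Fin d → 𝔸ˣ) (A : Site d → Fin d → 𝔸) (y : Site d) :
    Fcov L V₀ (expCfg ((0 : ℂ) • A)) y = 0 := by
  unfold Fcov
  exact Finset.sum_eq_zero fun r _ => by rw [tHol_expCfg_zero_smul, Units.val_one, mlog_one, smul_zero]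

/-- **the block frame `\overline{R_{0,y}e^{tA}}` has derivative `F̂_{V₀}(y)` at `t = 0`** (`exp` through `0`:
`B7Eq78Linearization.hasDerivAt_exp_comp_zero`). [cite: Balaban1985Averaging, (110)–(112) p.34] -/
theorem hasDerivAt_wframe_expCfg (V₀ : Site d → Fin d → 𝔸ˣ) (A : Site d → Fin d → 𝔸) (y : Site d) :
    HasDerivAt (fun t : ℂ => ((wframe L V₀ (expCfg (t • A)) y : 𝔸ˣ) : 𝔸)) (FhatCov L V₀ A y) 0 := by
  simp only [wframe, val_expUnit]
  exact hasDerivAt_exp_comp_zero (Fcov_expCfg_zero_smul L V₀ A y) (hasDerivAt_Fcov_expCfg L V₀ A y)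

/-- … and its inverse `(\overline{R_{0,y}e^{tA}})⁻¹ = exp(−F(y))` has derivative `−F̂_{V₀}(y)` (the frame
`(\overline{R_{0,c₋}V₁})⁻¹` of (89)/(120)). [cite: Balaban1985Averaging, (120) p.35, (89) p.31] -/
theorem hasDerivAt_wframe_inv_expCfg (V₀ : Site d → Fin d → 𝔸ˣ) (A : Site d → Fin d → 𝔸) (y : Site d) :
    HasDerivAt (fun t : ℂ => (((wframe L V₀ (expCfg (t • A)) y)⁻¹ : 𝔸ˣ) : 𝔸)) (-FhatCov L V₀ A y) 0 := by
  simp only [wframe, val_inv_expUnit, val_expUnit]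
  exact hasDerivAt_exp_comp_zero (by rw [Fcov_expCfg_zero_smul, neg_zero]) (hasDerivAt_Fcov_expCfg L V₀ A y).neg

end Frames

/-! ## §4 The main term (125) at a general background and its bound `|(Q₀A)_c| ≤ |A|` -/

section MainTerm

variable (L : ℕ)

omit [CompleteSpace 𝔸] in
/-- **(125)** "(Q₀A)_c = (Q_{V₀}A)_c = Σ_{x∈B(c₋)} L^{−(d+1)}(R_{0,c₋}A)([x, x′])" for the `L`-bond `c = ⟨q, q + Le_κ⟩`,
`x = q + r ∈ B(c₋)`, `x′ = x + Le_κ`: the straight segment `[x, x′]` (`seg κ L`) summed with the rotations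
`R_{0,c₋}` transported from `c₋` along the tree contour `Γ_{c₋,x}` (`treeWord r`) — i.e. the `[x, x′]`-piece of
`(R_{0,c₋}A)(Γ_{c₋,x} ∪ [x, x′])` (`tsum_append`). At `V₀ = 1` it is `B7Prop3Flat.Q0form`. "it resembles the definition
of the averaging operation Q in [2]". [cite: Balaban1985Averaging, (125) p.36] -/
def Q0cov (V₀ : Site d → Fin d → 𝔸ˣ) (A : Site d → Fin d → 𝔸) (q : Site d) (κ : Fin d) : 𝔸 :=
  ∑ r : Fin d → Fin L, (((L : ℝ) ^ (d + 1))⁻¹) •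
    conjR (hol V₀ q (treeWord (boxVec L r))) (tsum V₀ A (q + boxVec L r) (seg κ L))

omit [NormedAlgebra ℂ 𝔸] [CompleteSpace 𝔸] in
/-- the summand of (125) IS the segment piece of the rotated functional along `Γ_{c₋,x} ∪ [x, x′]`:
`(R_{0,c₋}A)(Γ_{c₋,x} ∪ [x,x′]) = (R_{0,c₋}A)(Γ_{c₋,x}) + R(V₀(Γ_{c₋,x}))(R_{0,x}A)([x,x′])`. [cite: Balaban1985Averaging, (125) p.36, (115) p.34] -/
theorem tsum_treeWord_seg (V₀ : Site d → Fin d → 𝔸ˣ) (A : Site d → Fin d → 𝔸) (q : Site d) (κ : Fin d)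
    (r : Fin d → Fin L) :
    tsum V₀ A q (treeWord (boxVec L r) ++ seg κ L)
      = tsum V₀ A q (treeWord (boxVec L r))
        + conjR (hol V₀ q (treeWord (boxVec L r))) (tsum V₀ A (q + boxVec L r) (seg κ L)) := by
  rw [tsum_append, disp_treeWord]

omit [CompleteSpace 𝔸] in
/-- flat reduction: `Q₀` at `V₀ = 1` is `B7Prop3Flat.Q0form` ((125) with `R_{0,c₋} = id`). [cite: Balaban1985Averaging, (125) p.36] -/
@[simp] theorem Q0cov_one_left (A : Site d → Fin d → 𝔸) (q : Site d) (κ : Fin d) :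
    Q0cov L (1 : Site d → Fin d → 𝔸ˣ) A q κ = Q0form L A q κ := by
  simp [Q0cov, Q0form, hol_one, conjR_apply]

omit [CompleteSpace 𝔸] in
/-- **"and it has an estimate |(Q₀A)_c| ≤ |A| < α₁"** (display after (125)), at a general background with
`‖V₀(b)‖, ‖V₀(b)⁻¹‖ ≤ 1`: each of the `L^d` sites contributes `L` rotated bond variables of norm `≤ a`, weighted
`L^{−(d+1)}`. [cite: Balaban1985Averaging, (125)–(126) p.36] -/
theorem norm_Q0cov_le [NormOneClass 𝔸] (hL : 1 ≤ L) {V₀ : Site d → Fin d → 𝔸ˣ} (hV₀ : ∀ x κ, V₀ x κ ∈ U1 𝔸)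
    {A : Site d → Fin d → 𝔸} {a : ℝ} (hA : ∀ x κ, ‖A x κ‖ ≤ a) (q : Site d) (κ : Fin d) :
    ‖Q0cov L V₀ A q κ‖ ≤ a := by
  have hLpos : (0 : ℝ) < L := by exact_mod_cast hL
  unfold Q0cov
  calc ‖∑ r : Fin d → Fin L, (((L : ℝ) ^ (d + 1))⁻¹) •
          conjR (hol V₀ q (treeWord (boxVec L r))) (tsum V₀ A (q + boxVec L r) (seg κ L))‖
      ≤ ∑ r : Fin d → Fin L, (((L : ℝ) ^ (d + 1))⁻¹) * (L * a) := by
        refine norm_sum_le_of_le _ fun r _ => ?_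
        rw [norm_smul, Real.norm_of_nonneg (by positivity)]
        refine mul_le_mul_of_nonneg_left ?_ (by positivity)
        refine (norm_conjR_le (hol_mem hV₀ _ _) _).trans ?_
        have h := norm_tsum_le hV₀ hA (q + boxVec L r) (seg κ L)
        rwa [length_seg, Int.natAbs_natCast] at h
    _ = a := by
        rw [Finset.sum_const, Finset.card_univ, Fintype.card_pi, Finset.prod_const, Finset.card_univ,
          Fintype.card_fin, Fintype.card_fin, nsmul_eq_mul, Nat.cast_pow, pow_succ]
        field_simp

end MainTerm

/-! ## §5 The objects (121)–(122) at a general background; the frame part of (120)/(124) -/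

section Objects

variable (L : ℕ)

/-- **(121)** "Q(V₀, A, c) = (1/i) log(V̿₁)_c" for the double-bar average (89) at the background `V₀`
(`B7Eq92Concrete.dbavgCov`) of the configuration `V₁ = e^{A}` (109) (`B7Prop3Flat.expCfg`; the `i` absorbed into `A`,
`log` = the series (21), lineage conventions); at `V₀ = 1` it is `mlog (dbavg L (expCfg A) q κ)` of `B7Prop3Flat`.
[cite: Balaban1985Averaging, (121) p.36] -/
def Qcov (V₀ : Site d → Fin d → 𝔸ˣ) (A : Site d → Fin d → 𝔸) (q : Site d) (κ : Fin d) : 𝔸 :=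
  mlog ((dbavgCov L V₀ (expCfg A) q κ : 𝔸ˣ) : 𝔸)

/-- flat reduction of (121). [cite: Balaban1985Averaging, (121) p.36] -/
theorem Qcov_one_left (A : Site d → Fin d → 𝔸) (q : Site d) (κ : Fin d) :
    Qcov L (1 : Site d → Fin d → 𝔸ˣ) A q κ = mlog ((dbavg L (expCfg A) q κ : 𝔸ˣ) : 𝔸) := by
  rw [Qcov, dbavgCov_one_left]

/-- `Ṽ₁ = 1` for `V₁ = 1` ((65): `(\overline{1·V₀})_c(V̄₀)_c⁻¹ = 1`). [cite: Balaban1985Averaging, (65) p.29, (113) p.34] -/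
theorem tild_one_right (V₀ : Site d → Fin d → 𝔸ˣ) (q : Site d) (κ : Fin d) :
    tild L V₀ (1 : Site d → Fin d → 𝔸ˣ) q κ = 1 := by
  rw [tild_apply, one_mul, mul_inv_cancel]

/-- the block frame (110) of the unit configuration is `1` (every twisted transport of `1` is `1`). [cite: Balaban1985Averaging, (110) p.34] -/
theorem wframe_one_right (V₀ : Site d → Fin d → 𝔸ˣ) (y : Site d) :
    wframe L V₀ (1 : Site d → Fin d → 𝔸ˣ) y = 1 := by
  have h : Fcov L V₀ (1 : Site d → Fin d → 𝔸ˣ) y = 0 := by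
    have := Fcov_expCfg_zero_smul L V₀ (0 : Site d → Fin d → 𝔸) y
    rwa [zero_smul, expCfg_zero] at this
  exact Units.ext (by rw [wframe, val_expUnit, h, exp_zero, Units.val_one])

/-- **`V̿₁ = 1` at `V₁ = 1`**: the double-bar average of the unit configuration is the unit, at EVERY background.
[cite: Balaban1985Averaging, (89) p.31] -/
theorem dbavgCov_one_right (V₀ : Site d → Fin d → 𝔸ˣ) (q : Site d) (κ : Fin d) :
    dbavgCov L V₀ (1 : Site d → Fin d → 𝔸ˣ) q κ = 1 := by
  rw [dbavgCov_apply, wframe_one_right, wframe_one_right, tild_one_right, inv_one, one_mul, one_mul, map_one]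

/-- **`Q(V₀, 0, c) = 0`**: the Taylor expansion of (121) has no constant term ("from (120) it follows that its Taylor
expansion begins with a first-order polynomial"). [cite: Balaban1985Averaging, (121)–(122) p.36] -/
theorem Qcov_zero (V₀ : Site d → Fin d → 𝔸ˣ) (q : Site d) (κ : Fin d) :
    Qcov L V₀ (0 : Site d → Fin d → 𝔸) q κ = 0 := by
  rw [Qcov, expCfg_zero, dbavgCov_one_right, Units.val_one, mlog_one]

/-- **(122), the linear part «L(Q(V₀)A)_c»** — "then Q(V₀, A, c) is an analytic function of A and from (120) it follows
that its Taylor expansion begins with a first-order polynomial. Let us denote it by L(Q(V₀)A)_c" — typed as the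
first-order Taylor term along the ray through `A`: the `t`-derivative at `0` of `t ↦ Q(V₀, tA, c)` (Mathlib `deriv`;
for the analytic `Q` of Prop. 3 this is the printed first-order polynomial evaluated at `A`; READING C-adv4-22: it equals
`L·(Q(V₀)A)_c` with `L` the block size, (124)–(126) bounding the `L^{−(d+1)}`-normalised form). Its closed form (124)
and the bound (126) are the sequel's; at `V₀ = 1` it is `B7Prop3Flat.linQ` (`linQcov_one_left`). [cite: Balaban1985Averaging, (122) p.36] -/
def linQcov (V₀ : Site d → Fin d → 𝔸ˣ) (A : Site d → Fin d → 𝔸) (q : Site d) (κ : Fin d) : 𝔸 :=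
  deriv (fun t : ℂ => Qcov L V₀ (t • A) q κ) 0

/-- **(122), the remainder** "C(V₀, A, c) is an analytic function of A whose Taylor's expansion begins with a
second-order polynomial": typed as the difference `Q(V₀, A, c) − L(Q(V₀)A)_c`, so that (122)
"Q(V₀, A, c) = L(Q(V₀)A)_c + C(V₀, A, c)" holds by definition (`Qcov_eq_linQcov_add_Ccov`); its bound (123) is the
analyticity half of Prop. 3, not made here. [cite: Balaban1985Averaging, (122)–(123) p.36] -/
def Ccov (V₀ : Site d → Fin d → 𝔸ˣ) (A : Site d → Fin d → 𝔸) (q : Site d) (κ : Fin d) : 𝔸 :=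
  Qcov L V₀ A q κ - linQcov L V₀ A q κ

/-- **(122)** "Q(V₀, A, c) = L(Q(V₀)A)_c + C(V₀, A, c)" (by the definition of `Ccov`). [cite: Balaban1985Averaging, (122) p.36] -/
theorem Qcov_eq_linQcov_add_Ccov (V₀ : Site d → Fin d → 𝔸ˣ) (A : Site d → Fin d → 𝔸) (q : Site d) (κ : Fin d) :
    Qcov L V₀ A q κ = linQcov L V₀ A q κ + Ccov L V₀ A q κ := by
  rw [Ccov, add_sub_cancel]

/-- flat reduction of the linear part: at `V₀ = 1`, «L(Q(1)A)_c» is the main term `L·(Q₀A)_c` of `B7Prop3Flat`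
(`hasDerivAt_mlog_dbavg_complexRay` BY NAME; `A` bounded). [cite: Balaban1985Averaging, (122) + (125) p.36] -/
theorem linQcov_one_left [NormOneClass 𝔸] (hL : 1 ≤ L) (A : Site d → Fin d → 𝔸) {M : ℝ} (hM0 : 0 ≤ M)
    (hM : ∀ x κ, ‖A x κ‖ ≤ M) (q : Site d) (κ : Fin d) :
    linQcov L (1 : Site d → Fin d → 𝔸ˣ) A q κ = linQ L A q κ := by
  unfold linQcov
  simp only [Qcov_one_left]
  exact (hasDerivAt_mlog_dbavg_complexRay A hM0 hM L hL q κ).deriv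

/-- **THE FRAME PART OF (120)/(124).**  Along `V₁ = e^{tA}` the double-bar average (89)
`V̿₁(c) = (\overline{R_{0,c₋}V₁})⁻¹ · Ṽ₁(c) · R̄_{0,c}\overline{R_{0,c₊}V₁}` passes through `1` at `t = 0`, and the two
frames contribute `−F̂_{V₀}(c₋)` and `R̄_{0,c}F̂_{V₀}(c₊)` to its derivative: IF `Ṽ₁(c)` has `t`-derivative `D` at `0`
then `Q(V₀, tA, c)` has `t`-derivative `−F̂_{V₀}(c₋) + D + R̄_{0,c}F̂_{V₀}(c₊)` — the first and third terms of the exponent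
of (120) ("−i Σ_{x∈B(c₋)} L^{−d}(R_{0,c₋}A)(Γ_{c₋,x}) + i(Q′(V₀)A)_c + i Σ_{x′∈B(c₊)} L^{−d} R̄_{0,c}(R_{0,c₊}A)(Γ_{c₊,x′})"),
the middle one `(Q′(V₀)A)_c` (113)–(119) being `D`, the sequel's. [cite: Balaban1985Averaging, (120) p.35, (89) p.31] -/
theorem hasDerivAt_Qcov_of_tild (V₀ : Site d → Fin d → 𝔸ˣ) (A : Site d → Fin d → 𝔸) (q : Site d) (κ : Fin d)
    {D : 𝔸} (hD : HasDerivAt (fun t : ℂ => ((tild L V₀ (expCfg (t • A)) q κ : 𝔸ˣ) : 𝔸)) D 0) :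
    HasDerivAt (fun t : ℂ => Qcov L V₀ (t • A) q κ)
      (-FhatCov L V₀ A q + D + conjR (bavg L V₀ q κ) (FhatCov L V₀ A (q + (L : ℤ) • e κ))) 0 := by
  have h1 := hasDerivAt_wframe_inv_expCfg L V₀ A q
  have h3 := hasDerivAt_conjR_comp (bavg L V₀ q κ) (hasDerivAt_wframe_expCfg L V₀ A (q + (L : ℤ) • e κ))
  have h := (h1.fun_mul hD).fun_mul h3
  -- values at `t = 0`: every factor is `1`
  have e1 : (((wframe L V₀ (expCfg ((0 : ℂ) • A)) q)⁻¹ : 𝔸ˣ) : 𝔸) = 1 := by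
    rw [zero_smul, expCfg_zero, wframe_one_right, inv_one, Units.val_one]
  have e2 : ((tild L V₀ (expCfg ((0 : ℂ) • A)) q κ : 𝔸ˣ) : 𝔸) = 1 := by
    rw [zero_smul, expCfg_zero, tild_one_right, Units.val_one]
  have e3 : conjR (bavg L V₀ q κ) ((wframe L V₀ (expCfg ((0 : ℂ) • A)) (q + (L : ℤ) • e κ) : 𝔸ˣ) : 𝔸) = 1 := by
    rw [zero_smul, expCfg_zero, wframe_one_right, Units.val_one, conjR_one]
  simp only [e1, e2, e3, mul_one, one_mul] at h
  have hval : ∀ t : ℂ, Qcov L V₀ (t • A) q κ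
      = mlog ((((wframe L V₀ (expCfg (t • A)) q)⁻¹ : 𝔸ˣ) : 𝔸) * ((tild L V₀ (expCfg (t • A)) q κ : 𝔸ˣ) : 𝔸)
          * conjR (bavg L V₀ q κ) ((wframe L V₀ (expCfg (t • A)) (q + (L : ℤ) • e κ) : 𝔸ˣ) : 𝔸)) := by
    intro t
    rw [Qcov, dbavgCov_apply, Units.val_mul, Units.val_mul, conjR_apply, Rc_apply, Units.val_mul, Units.val_mul]
  simp_rw [hval]
  refine hasDerivAt_mlog_comp ?_ h
  rw [e1, e2, e3, mul_one, mul_one]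

/-- hence, in `deriv` form: «L(Q(V₀)A)_c» `= −F̂_{V₀}(c₋) + D + R̄_{0,c}F̂_{V₀}(c₊)` whenever `Ṽ₁` has derivative `D`.
[cite: Balaban1985Averaging, (120) p.35, (122) p.36] -/
theorem linQcov_eq_of_tild (V₀ : Site d → Fin d → 𝔸ˣ) (A : Site d → Fin d → 𝔸) (q : Site d) (κ : Fin d)
    {D : 𝔸} (hD : HasDerivAt (fun t : ℂ => ((tild L V₀ (expCfg (t • A)) q κ : 𝔸ˣ) : 𝔸)) D 0) :
    linQcov L V₀ A q κ = -FhatCov L V₀ A q + D + conjR (bavg L V₀ q κ) (FhatCov L V₀ A (q + (L : ℤ) • e κ)) :=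
  (hasDerivAt_Qcov_of_tild L V₀ A q κ hD).deriv

end Objects

end Literature.MathematicalPhysics.QuantumFieldTheory.Balaban1983to89.B7Prop3GeneralLinear

end
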